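import Summits.HodgeConjecture.HodgeConjecture.Theorems.F0P3ArchIsotypyCM
import Summits.HodgeConjecture.HodgeConjecture.Theorems.F0P3bHolAntiholInequivalent
import Summits.HodgeConjecture.HodgeConjecture.Theorems.F0P3PNullMapIsCocycle
import Literature.NumberTheory.Rogawski1990.CohomologicalSpectrumInnerForm
import HarnessLib

/-!
# FLOOR-0 P3 — rung-2 fold: letter E2′ `Rogawski1990.hodgeTypeRigid` FROM the archimedean-rigidity statement β
# («cohomological discrete `P, P′` of `U(H)` with a common finite component have `(𝔤, K)`-equivalent archimedean
# constituents at `ι`»), letter F1a at the pin, and the value maps of cotangent forms (B1′)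

Cell hodgecm-mathlib, FLOOR 0, crux item H413 = stmt-HodgeConjecture-24833; rung-1 line `Cruxes/H413/Lines/F0_U3LettersRung1.lean`
(`stub_E2p : Rogawski1990.hodgeTypeRigid`); E2′ dossier `F0/P3/p03/E2PRIME-RUNG2.md` (F0P3-p03 (g3)) OPTION β.  PROOF lane (no `def`).

The hypothesis `hβ` is the dossier's LETTER-WANTED statement β = [Rogawski1990, Thm. 13.3.6 (c) + §15.3 ¶1 (inner form, CM case p. 250);
§14.6 set-up of Thm. 14.6.4 and its proof l. 1 («unique ξ»); Thm. 13.3.5; §12.3 p. 174; Prop. 15.2.1 (a)(b)] ∘ [Flath1979 Thm 3–4; BorelJacquet1979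
§4.6], spelled INLINE with exactly the binders a Literature `def cohArchComponentRigid : Prop` would have (typ3-shaped: the letter frame of
E2′ + the D4 ∕ F1a currency `archModuleCM ∕ archRepKCM ∕ archRepLieCM` + T6c's cohomology token ★ `upqTypeClasses … 1 δ ≠ ⊥`), so that once the
typer files β the closer `stub_E2p := hodgeTypeRigid_of_cohArchComponentRigid hβ …` is by `defeq`.  The other hypotheses: `hF1a` ∕ `hF1a'` = letter
F1a ★ `DiscreteAutomorphicRep.ArchIsotypy` at the CM pin for holomorphic- resp. antiholomorphic-type `P` (the rung-1 line's `StubF1aCM` v2 and its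
antiholomorphic twin); `hVal` ∕ `hVal'` = the value-map heads of brief B1′ (`F0P3CotangentFormValueMap`, F0P3-p01 (g3)), binders TOKEN-IDENTICAL to
F0P3-p04 (g3)'s `cohFinComponentUnique_hol_of_valueMaps_of_holType`.

PROOF of `hodgeTypeRigid_of_cohArchComponentRigid`: `P` hol ∕ `P′` antihol with common `σ`; B1′ gives non-zero typed value maps `φ` (type `+I`) on
`P.archModuleCM`, `φ′` (type `−I`) on `P′.archModuleCM`; F1a at the pin (★ `F0P3ArchIsotypyCM.exists_detecting_irreducible`) gives irreducible
admissible `M`, `M′` and `(𝔤, K)`-maps `T`, `T′` detecting `φ X₀ ≠ 0`, `φ′ X₁ ≠ 0`; `T ∘ φ`, `T′ ∘ φ′` are typed value maps on `M`, `M′` (★ S2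
`valueMap_comp`), non-zero, so `H¹₊₁(M) ≠ 0`, `H¹₋₁(M′) ≠ 0` (★ J2 `typeClasses_ne_bot_of_linearMap`); β gives `M ≃ M′`; ★
`F0P3bHolAntiholInequivalent.hol_antihol_inequivalent_of_irreducible` (T6a purity transported) is the contradiction.
References: [Rogawski1990] Thm. 13.3.6 (c), Thm. 13.3.5, §14.6 Thm. 14.6.4, §12.3 p. 174, Prop. 15.2.1, §15.3 ¶1; [BorelWallach2000] VI 4.11, II §4.2;
[FlathCorvallis1979] Thm. 3.  HONEST LABEL: HC_CM is proved only modulo the printed citations until rung 0 closes; this file discharges none of them.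
-/

-- Mathlib idiom (as in `GKModules`, ★ F1a, ★ S0∕S2∕S3): commutator bracket on `Module.End`
attribute [local instance 100] LieRing.ofAssociativeRing

set_option autoImplicit false
set_option linter.dupNamespace false

noncomputable section

namespace Summit.HodgeConjecture.HodgeConjecture.Cruxes.H413.F0P3HodgeTypeRigidOfArchRigid

open NumberField NumberField.InfinitePlace MeasureTheory
open scoped Matrix MatrixGroups ComplexOrder
open Literature.Geometry.ComplexHyperbolic.BallModel (U21)
open Literature.RepresentationTheory.BorelWallach2000
open Literature.NumberTheory.Automorphic Literature.NumberTheory.Automorphic.UnitaryGroup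
open Literature.NumberTheory.Automorphic.UnitaryGroup.CotangentForms
open Literature.RepresentationTheory.KonnoKonno2007 Literature.RepresentationTheory.KonnoKonno2007.RealDualPair
open Literature.RepresentationTheory.KonnoKonno2007.RealDualPair.UForm
open Summit.HodgeConjecture.HodgeConjecture.Cruxes.H413.F0P3ArchIsotypyCM
open Summit.HodgeConjecture.HodgeConjecture.Cruxes.H413.F0P3ValueMapTransport
open Summit.HodgeConjecture.HodgeConjecture.Cruxes.H413.F0P3PNullMapIsCocycle
open Summit.HodgeConjecture.HodgeConjecture.Cruxes.H413.F0P3bArchDegOnePackage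

/-! Scalar bookkeeping on a GENERIC module (so that no goal over `P.archModuleCM` is rewritten): the value-map weight and
nullity clauses with the literal scalars `I` ∕ `-I` of B1′ are the `δ = 1` ∕ `δ = -1` instances of the `((δ : ℂ) * I)`-clauses of ★ S2. -/

/-- Weight clause, `((δ:ℂ) = 1)`-form. [folklore] -/
theorem eq_intCast_mul_I_smul_of_eq_one {V : Type*} [AddCommGroup V] [Module ℂ V] {δ : ℤ} (hδ : (δ : ℂ) = 1) {a b : V}
    (h : a = Complex.I • b) : a = ((δ : ℂ) * Complex.I) • b := by
  rw [hδ, one_mul]; exact h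

/-- Nullity clause, `((δ:ℂ) = 1)`-form. [folklore] -/
theorem add_intCast_mul_I_smul_eq_zero_of_eq_one {V : Type*} [AddCommGroup V] [Module ℂ V] {δ : ℤ} (hδ : (δ : ℂ) = 1)
    {a b : V} (h : a + Complex.I • b = 0) : a + ((δ : ℂ) * Complex.I) • b = 0 := by
  rw [hδ, one_mul]; exact h

/-- Weight clause, `((δ:ℂ) = -1)`-form. [folklore] -/
theorem eq_intCast_mul_I_smul_of_eq_neg_one {V : Type*} [AddCommGroup V] [Module ℂ V] {δ : ℤ} (hδ : (δ : ℂ) = -1) {a b : V}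
    (h : a = (-Complex.I) • b) : a = ((δ : ℂ) * Complex.I) • b := by
  rw [hδ, neg_one_mul]; exact h

/-- Nullity clause, `((δ:ℂ) = -1)`-form. [folklore] -/
theorem add_intCast_mul_I_smul_eq_zero_of_eq_neg_one {V : Type*} [AddCommGroup V] [Module ℂ V] {δ : ℤ} (hδ : (δ : ℂ) = -1)
    {a b : V} (h : a + (-Complex.I) • b = 0) : a + ((δ : ℂ) * Complex.I) • b = 0 := by
  rw [hδ, neg_one_mul]; exact h

/-- **Letter E2′ `hodgeTypeRigid` from β (archimedean rigidity of cohomological discrete representations with a common finite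
component), letter F1a at the CM pin (hol- and antihol-type instances) and the value maps of cotangent forms (B1′).**
`hβ` is the E2′-dossier's statement β with Literature-shaped binders; `hF1a`∕`hF1a'` are ★ `DiscreteAutomorphicRep.ArchIsotypy` at
`(uFormGroup (Fin 2) (Fin 1), cmArchSectionUForm L ι H T hT)` for `P` of holomorphic resp. antiholomorphic cotangent type; `hVal`∕`hVal'`
are the B1′ heads (non-zero typed-`±I` null value maps on `P.archModuleCM ι T hT` from a non-zero (anti)holomorphic cotangent form with
classes in `P`).  See the module docstring for the proof. [cite: Rogawski1990, Thm. 13.3.6 (c); Thm. 13.3.5; §14.6 Thm. 14.6.4; §12.3 p. 174;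
Prop. 15.2.1; §15.3 ¶1] [cite: BorelWallach2000, VI Thm. 4.11; II §4.2] [cite: FlathCorvallis1979, Thm. 3] -/
theorem hodgeTypeRigid_of_cohArchComponentRigid
    (hβ : ∀ (L : Type) [Field L] [NumberField L] [IsCMField L] (ι : L →+* ℂ) (H : Matrix (Fin 3) (Fin 3) L) (T : GL (Fin 3) ℂ)
      (hT : (T : Matrix (Fin 3) (Fin 3) ℂ)ᴴ * H.map ι * (T : Matrix (Fin 3) (Fin 3) ℂ) = Literature.Geometry.ComplexHyperbolic.BallModel.J),
      (∀ τ' : L →+* ℂ, InfinitePlace.mk τ' ≠ InfinitePlace.mk ι → (H.map τ').PosDef) →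
      2 ≤ Module.finrank ℚ ↥(maximalRealSubfield L) →
      ∀ (μ : Measure (adelicGroupData (↥(maximalRealSubfield L)) L (IsCMField.complexConj L) 3 H).automorphicQuotient)
        [(adelicGroupData (↥(maximalRealSubfield L)) L (IsCMField.complexConj L) 3 H).IsAutomorphicMeasure μ]
        (W : Type) [AddCommGroup W] [Module ℂ W]
        (σ : Representation ℂ (finAdelic (↥(maximalRealSubfield L)) L (IsCMField.complexConj L) 3 H) W),
        σ.IsIrreducible → σ.IsSmooth →
      ∀ (P P' : DiscreteAutomorphicRep (adelicGroupData (↥(maximalRealSubfield L)) L (IsCMField.complexConj L) 3 H) μ),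
        P.HasFinComponent σ → P'.HasFinComponent σ →
      ∀ (M : Type) [AddCommGroup M] [Module ℂ M] (σK : Representation ℂ (uFormGroup (Fin 2) (Fin 1)).maximalCompact M)
        (σ𝔤 : (uFormGroup (Fin 2) (Fin 1)).lie →ₗ⁅ℝ⁆ Module.End ℂ M) (hM : IsGKModule (uFormGroup (Fin 2) (Fin 1)) σK σ𝔤),
        IsIrreducibleGK σK σ𝔤 →
        (∃ T₁ : P.archModuleCM ι T hT →ₗ[ℂ] M,
          (∀ (k : (uFormGroup (Fin 2) (Fin 1)).maximalCompact) (w : P.archModuleCM ι T hT),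
              T₁ (P.archRepKCM ι T hT k w) = σK k (T₁ w)) ∧
            (∀ (X : (uFormGroup (Fin 2) (Fin 1)).lie) (w : P.archModuleCM ι T hT),
              T₁ (P.archRepLieCM ι T hT X w) = σ𝔤 X (T₁ w)) ∧ T₁ ≠ 0) →
      ∀ (M' : Type) [AddCommGroup M'] [Module ℂ M'] (σK' : Representation ℂ (uFormGroup (Fin 2) (Fin 1)).maximalCompact M')
        (σ𝔤' : (uFormGroup (Fin 2) (Fin 1)).lie →ₗ⁅ℝ⁆ Module.End ℂ M') (hM' : IsGKModule (uFormGroup (Fin 2) (Fin 1)) σK' σ𝔤'),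
        IsIrreducibleGK σK' σ𝔤' →
        (∃ T₂ : P'.archModuleCM ι T hT →ₗ[ℂ] M',
          (∀ (k : (uFormGroup (Fin 2) (Fin 1)).maximalCompact) (w : P'.archModuleCM ι T hT),
              T₂ (P'.archRepKCM ι T hT k w) = σK' k (T₂ w)) ∧
            (∀ (X : (uFormGroup (Fin 2) (Fin 1)).lie) (w : P'.archModuleCM ι T hT),
              T₂ (P'.archRepLieCM ι T hT X w) = σ𝔤' X (T₂ w)) ∧ T₂ ≠ 0) →
      ∀ (δ δ' : ℤ), (δ = 1 ∨ δ = -1) → (δ' = 1 ∨ δ' = -1) →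
        upqTypeClasses σK σ𝔤 hM.ad_compat 1 δ ≠ ⊥ → upqTypeClasses σK' σ𝔤' hM'.ad_compat 1 δ' ≠ ⊥ →
        AreGKEquivalent σK σ𝔤 σK' σ𝔤')
    (hF1a : ∀ (L : Type) [Field L] [NumberField L] [IsCMField L] (ι : L →+* ℂ) (H : Matrix (Fin 3) (Fin 3) L) (T : GL (Fin 3) ℂ)
      (hT : (T : Matrix (Fin 3) (Fin 3) ℂ)ᴴ * H.map ι * (T : Matrix (Fin 3) (Fin 3) ℂ) = Literature.Geometry.ComplexHyperbolic.BallModel.J)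
      (μ : Measure (adelicGroupData (↥(maximalRealSubfield L)) L (IsCMField.complexConj L) 3 H).automorphicQuotient)
      [(adelicGroupData (↥(maximalRealSubfield L)) L (IsCMField.complexConj L) 3 H).IsAutomorphicMeasure μ]
      (P : DiscreteAutomorphicRep (adelicGroupData (↥(maximalRealSubfield L)) L (IsCMField.complexConj L) 3 H) μ),
      P.IsHolCotangentAt (cmArchSection L ι H T hT) (cmCompactFactor L ι H T hT) →
      P.ArchIsotypy (uFormGroup (Fin 2) (Fin 1)) (cmArchSectionUForm L ι H T hT))
    (hF1a' : ∀ (L : Type) [Field L] [NumberField L] [IsCMField L] (ι : L →+* ℂ) (H : Matrix (Fin 3) (Fin 3) L) (T : GL (Fin 3) ℂ)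
      (hT : (T : Matrix (Fin 3) (Fin 3) ℂ)ᴴ * H.map ι * (T : Matrix (Fin 3) (Fin 3) ℂ) = Literature.Geometry.ComplexHyperbolic.BallModel.J)
      (μ : Measure (adelicGroupData (↥(maximalRealSubfield L)) L (IsCMField.complexConj L) 3 H).automorphicQuotient)
      [(adelicGroupData (↥(maximalRealSubfield L)) L (IsCMField.complexConj L) 3 H).IsAutomorphicMeasure μ]
      (P : DiscreteAutomorphicRep (adelicGroupData (↥(maximalRealSubfield L)) L (IsCMField.complexConj L) 3 H) μ),
      P.IsAntiholCotangentAt (cmArchSection L ι H T hT) (cmCompactFactor L ι H T hT) →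
      P.ArchIsotypy (uFormGroup (Fin 2) (Fin 1)) (cmArchSectionUForm L ι H T hT))
    (hVal : ∀ (L : Type) [Field L] [NumberField L] [IsCMField L] (ι : L →+* ℂ) (H : Matrix (Fin 3) (Fin 3) L) (T : GL (Fin 3) ℂ)
      (hT : (T : Matrix (Fin 3) (Fin 3) ℂ)ᴴ * H.map ι * (T : Matrix (Fin 3) (Fin 3) ℂ) = Literature.Geometry.ComplexHyperbolic.BallModel.J),
      (∀ τ' : L →+* ℂ, InfinitePlace.mk τ' ≠ InfinitePlace.mk ι → (H.map τ').PosDef) →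
      2 ≤ Module.finrank ℚ ↥(maximalRealSubfield L) →
      ∀ (μ : Measure (adelicGroupData (↥(maximalRealSubfield L)) L (IsCMField.complexConj L) 3 H).automorphicQuotient)
      [(adelicGroupData (↥(maximalRealSubfield L)) L (IsCMField.complexConj L) 3 H).IsAutomorphicMeasure μ]
      (P : DiscreteAutomorphicRep (adelicGroupData (↥(maximalRealSubfield L)) L (IsCMField.complexConj L) 3 H) μ)
      (Φ : (adelicGroupData (↥(maximalRealSubfield L)) L (IsCMField.complexConj L) 3 H).Adelic → (Fin 2 → ℂ)),
      Φ ∈ CotangentForms.holCotForms (↥(maximalRealSubfield L)) L (IsCMField.complexConj L) 3 H (cmArchSection L ι H T hT)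
        (cmCompactFactor L ι H T hT) → Φ ≠ 0 → P.ContainsForm Φ →
      ∃ φ : (uFormGroup (Fin 2) (Fin 1)).lie →ₗ[ℝ] P.archModuleCM ι T hT, φ ≠ 0 ∧
        (∀ W ∈ (uFormGroup (Fin 2) (Fin 1)).kInLie, φ W = 0) ∧
        (∀ (k : (uFormGroup (Fin 2) (Fin 1)).maximalCompact) (X : (uFormGroup (Fin 2) (Fin 1)).lie),
          P.archRepKCM ι T hT k (φ X) =
            φ ((uFormGroup (Fin 2) (Fin 1)).Ad (Subgroup.inclusion (uFormGroup (Fin 2) (Fin 1)).maximalCompact_le_carrier k) X)) ∧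
        (∀ W ∈ (uFormGroup (Fin 2) (Fin 1)).kInLie, ∀ X : (uFormGroup (Fin 2) (Fin 1)).lie,
          φ ⁅W, X⁆ = P.archRepLieCM ι T hT W (φ X)) ∧
        (∀ X : (uFormGroup (Fin 2) (Fin 1)).lie, P.archRepLieCM ι T hT (upqZ0 (Fin 2) (Fin 1)) (φ X) = Complex.I • φ X) ∧
        (∀ (X : (uFormGroup (Fin 2) (Fin 1)).lie) (s : (Fin 2 × Fin 1) × Fin 2),
          P.archRepLieCM ι T hT (upqPBasis s) (φ X) +
            Complex.I • P.archRepLieCM ι T hT ⁅upqZ0 (Fin 2) (Fin 1), upqPBasis s⁆ (φ X) = 0))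
    (hVal' : ∀ (L : Type) [Field L] [NumberField L] [IsCMField L] (ι : L →+* ℂ) (H : Matrix (Fin 3) (Fin 3) L) (T : GL (Fin 3) ℂ)
      (hT : (T : Matrix (Fin 3) (Fin 3) ℂ)ᴴ * H.map ι * (T : Matrix (Fin 3) (Fin 3) ℂ) = Literature.Geometry.ComplexHyperbolic.BallModel.J),
      (∀ τ' : L →+* ℂ, InfinitePlace.mk τ' ≠ InfinitePlace.mk ι → (H.map τ').PosDef) →
      2 ≤ Module.finrank ℚ ↥(maximalRealSubfield L) →
      ∀ (μ : Measure (adelicGroupData (↥(maximalRealSubfield L)) L (IsCMField.complexConj L) 3 H).automorphicQuotient)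
      [(adelicGroupData (↥(maximalRealSubfield L)) L (IsCMField.complexConj L) 3 H).IsAutomorphicMeasure μ]
      (P : DiscreteAutomorphicRep (adelicGroupData (↥(maximalRealSubfield L)) L (IsCMField.complexConj L) 3 H) μ)
      (Ψ : (adelicGroupData (↥(maximalRealSubfield L)) L (IsCMField.complexConj L) 3 H).Adelic → (Fin 2 → ℂ)),
      Ψ ∈ (CotangentForms.holCotForms (↥(maximalRealSubfield L)) L (IsCMField.complexConj L) 3 H (cmArchSection L ι H T hT)
        (cmCompactFactor L ι H T hT)).map (CotangentForms.conjFun (↥(maximalRealSubfield L)) L (IsCMField.complexConj L) 3 H) →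
        Ψ ≠ 0 → P.ContainsForm Ψ →
      ∃ φ : (uFormGroup (Fin 2) (Fin 1)).lie →ₗ[ℝ] P.archModuleCM ι T hT, φ ≠ 0 ∧
        (∀ W ∈ (uFormGroup (Fin 2) (Fin 1)).kInLie, φ W = 0) ∧
        (∀ (k : (uFormGroup (Fin 2) (Fin 1)).maximalCompact) (X : (uFormGroup (Fin 2) (Fin 1)).lie),
          P.archRepKCM ι T hT k (φ X) =
            φ ((uFormGroup (Fin 2) (Fin 1)).Ad (Subgroup.inclusion (uFormGroup (Fin 2) (Fin 1)).maximalCompact_le_carrier k) X)) ∧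
        (∀ W ∈ (uFormGroup (Fin 2) (Fin 1)).kInLie, ∀ X : (uFormGroup (Fin 2) (Fin 1)).lie,
          φ ⁅W, X⁆ = P.archRepLieCM ι T hT W (φ X)) ∧
        (∀ X : (uFormGroup (Fin 2) (Fin 1)).lie, P.archRepLieCM ι T hT (upqZ0 (Fin 2) (Fin 1)) (φ X) = (-Complex.I) • φ X) ∧
        (∀ (X : (uFormGroup (Fin 2) (Fin 1)).lie) (s : (Fin 2 × Fin 1) × Fin 2),
          P.archRepLieCM ι T hT (upqPBasis s) (φ X) +
            (-Complex.I) • P.archRepLieCM ι T hT ⁅upqZ0 (Fin 2) (Fin 1), upqPBasis s⁆ (φ X) = 0)) :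
    Literature.NumberTheory.Rogawski1990.hodgeTypeRigid := by
  intro L _ _ _ ι H T hT hdef h2 μ _ W _ _ σ hirr hsm P P' hP hP' hfin hfin'
  -- letter F1a at the pin, for the hol-type `P` and the antihol-type `P′`
  have hIso := hF1a L ι H T hT μ P hP
  have hIso' := hF1a' L ι H T hT μ P' hP'
  -- the cotangent forms and their value maps (B1′)
  obtain ⟨Φ, hΦ, hΦ0, hcont⟩ := hP
  obtain ⟨Ψ, hΨ, hΨ0, hcont'⟩ := hP'
  obtain ⟨φ, hφ0, h0, hK, h𝔨, hwt, hN⟩ := hVal L ι H T hT hdef h2 μ P Φ hΦ hΦ0 hcont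
  obtain ⟨φ', hφ'0, h0', hK', h𝔨', hwt', hN'⟩ := hVal' L ι H T hT hdef h2 μ P' Ψ hΨ hΨ0 hcont'
  -- the detecting irreducible admissible modules (F1a unpacked at the pin) and detecting maps
  obtain ⟨M, _, _, σK, σ𝔤, hGK, hirrM, -, hdet⟩ := exists_detecting_irreducible ι T hT P hIso
  obtain ⟨M', _, _, σK', σ𝔤', hGK', hirrM', -, hdet'⟩ := exists_detecting_irreducible ι T hT P' hIso'
  obtain ⟨X₀, hX₀⟩ := exists_apply_ne_zero_of_ne_zero hφ0
  obtain ⟨X₁, hX₁⟩ := exists_apply_ne_zero_of_ne_zero hφ'0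
  obtain ⟨T₁, hT₁K, hT₁𝔤, hT₁⟩ := hdet _ hX₀
  obtain ⟨T₂, hT₂K, hT₂𝔤, hT₂⟩ := hdet' _ hX₁
  have hT₁0 : T₁ ≠ 0 := fun h => hT₁ (h ▸ rfl)
  have hT₂0 : T₂ ≠ 0 := fun h => hT₂ (h ▸ rfl)
  -- typed value maps on `M`, `M′` and the cohomology classes they give
  have c1 : ((1 : ℤ) : ℂ) = 1 := Int.cast_one
  have c2 : ((-1 : ℤ) : ℂ) = -1 := by rw [Int.cast_neg, Int.cast_one]
  obtain ⟨q0, qK, q𝔨, qwt, qN⟩ := valueMap_comp (δ := 1) φ T₁ hT₁K hT₁𝔤 h0 hK h𝔨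
    (fun X => eq_intCast_mul_I_smul_of_eq_one (V := ↥(P.archModuleCM ι T hT)) c1 (hwt X))
    (fun X s => add_intCast_mul_I_smul_eq_zero_of_eq_one (V := ↥(P.archModuleCM ι T hT)) c1 (hN X s))
  obtain ⟨r0, rK, r𝔨, rwt, rN⟩ := valueMap_comp (δ := -1) φ' T₂ hT₂K hT₂𝔤 h0' hK' h𝔨'
    (fun X => eq_intCast_mul_I_smul_of_eq_neg_one (V := ↥(P'.archModuleCM ι T hT)) c2 (hwt' X))
    (fun X s => add_intCast_mul_I_smul_eq_zero_of_eq_neg_one (V := ↥(P'.archModuleCM ι T hT)) c2 (hN' X s))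
  have hne : upqTypeClasses σK σ𝔤 hGK.ad_compat 1 1 ≠ ⊥ :=
    typeClasses_ne_bot_of_linearMap σK σ𝔤 hGK.ad_compat hirrM (Or.inl rfl) _
      (comp_ne_zero_of_apply_ne_zero φ T₁ hT₁) q0 qK q𝔨 qwt qN
  have hne' : upqTypeClasses σK' σ𝔤' hGK'.ad_compat 1 (-1) ≠ ⊥ :=
    typeClasses_ne_bot_of_linearMap σK' σ𝔤' hGK'.ad_compat hirrM' (Or.inr rfl) _
      (comp_ne_zero_of_apply_ne_zero φ' T₂ hT₂) r0 rK r𝔨 rwt rN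
  -- β: the two archimedean constituents are equivalent; T6a purity forbids it
  have he : AreGKEquivalent σK σ𝔤 σK' σ𝔤' :=
    hβ L ι H T hT hdef h2 μ W σ hirr hsm P P' hfin hfin' M σK σ𝔤 hGK hirrM ⟨T₁, hT₁K, hT₁𝔤, hT₁0⟩ M' σK' σ𝔤' hGK' hirrM'
      ⟨T₂, hT₂K, hT₂𝔤, hT₂0⟩ 1 (-1) (Or.inl rfl) (Or.inr rfl) hne hne'
  exact hol_antihol_inequivalent_of_irreducible hGK hGK' hirrM' hne hne' he

end Summit.HodgeConjecture.HodgeConjecture.Cruxes.H413.F0P3HodgeTypeRigidOfArchRigid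

end
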